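import Literature.AlgebraicGeometry.Motives.CurvePointDivisor
import Literature.AlgebraicGeometry.Motives.CurveRiemannRoch
import Literature.AlgebraicGeometry.Motives.SmoothOverRegularBase
import Literature.AlgebraicGeometry.Resolution.RegularLocalRingsUFD
import Literature.AlgebraicGeometry.Motives.RatFnBirationalHartogs
import HarnessLib

/-!
# The diagonal of a smooth proper curve as an effective Cartier divisor on `C × C`
# (Milne, *Jacobian Varieties*, §3 Example 3.12)

For a smooth proper geometrically integral curve `C / K` this file constructs the **diagonal
divisor `Δ`** on the smooth surface `C × C = (C ⊗ C).left` (monoidal product of `SchemeOver K`) as a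
reduced effective Cartier divisor, `diagonalDivisor C : CartierDivisor (C ⊗ C).left` — the basic
relative effective divisor of degree one from which Milne's canonical divisors
`D = Σ sᵢ(Cʳ) ⊂ C × Cʳ` and `D_can ⊂ C × C⁽ʳ⁾` (Example 3.12, Thm. 3.13) are built by pullback and
descent. As for the point divisors of `Motives/CurvePointDivisor`, the construction is the tree's
`ComplementDivisor.divisorOfPure` (`Motives/PureCodimOneDivisor`, Görtz–Wedhorn II Lemma 25.150:
a pure-codimension-one closed subset of a locally factorial integral scheme carries a reduced
effective Cartier divisor), whose hypotheses are verified: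

* `smoothOfRelativeDimension_two_tensor_hom`, `isIntegral_tensor_left`,
  `uniqueFactorizationMonoid_stalk_tensor` — `C × C` is a smooth (base change and composition),
  integral (`C` geometrically integral) surface with factorial local rings (regular:
  `isRegularLocalRing_stalk_of_smoothOfRelativeDimension_specOfRegular`; Auslander–Buchsbaum:
  the tree's `Matsumura1987_20_3_holds`);
* `diag`, `diagonalSet`, `isClosed_diagonalSet` — the diagonal `C → C ⊗ C` (`= pullback.diagonal`,
  a closed immersion as `C` is separated) and its closed image `Δ`;
* `height_top_tensor` (`dim C × C = 2`), `height_diagonalGenericPoint` (`= 1`, closed immersions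
  preserve heights), `coheight_diagonalGenericPoint` (**`codim Δ = 1`**, Stacks 0A21:
  `height + coheight = dim`, the tree's `Scheme.height_add_coheight_eq_height_top`),
  `height_eq_one_of_mem_minimalPrimes_diagonal` (purity in the algebraic form required);
* `diagonalDivisor`, `isEffective_diagonalDivisor`, `avoids_diagonalDivisor_iff` (support `= Δ`),
  `isDiscreteValuationRing_stalk_diagonalGenericPoint`, and
  **`ordAt_diagonalDivisor_genericPoint : ord_Δ(Δ) = 1`** (reducedness, from the radical local
  equations of `divisorOfPure`).

Everything is proved; no named facts (D-0026). The fibres `Δ|_{C × {P}} = [P]` are computed in a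
sequel.

Mathlib searched (pin): `pullback.diagonal`, `IsSeparated.isClosedImmersion_diagonal`,
`Over.tensorObj_left`, `smoothOfRelativeDimension_isStableUnderBaseChange`,
`smoothOfRelativeDimension_comp`, `idealHeight_eq_coheight`, `coheight_eq_of_isOpenImmersion`,
`ringKrullDim_stalk_eq_coheight`, `tfae_of_isNoetherianRing_of_isLocalRing_of_isDomain` (all used);
Mathlib has no divisors.

## References

* J. S. Milne, *Jacobian Varieties*, in: Arithmetic Geometry (Cornell–Silverman, eds.), Springer
  1986, §3, Example 3.12 and Thm. 3.13 (pp. 246–247 of the volume). [Milne1986JacobianVarieties]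
* U. Görtz, T. Wedhorn, *Algebraic Geometry II* (2023), Lemma 25.150. [GortzWedhorn2023]
* The Stacks Project, Tag 0A21. [StacksProject]
-/

noncomputable section

open CategoryTheory CategoryTheory.Limits AlgebraicGeometry IsLocalRing Order TopologicalSpace
  MonoidalCategory CartesianMonoidalCategory

universe u

namespace Literature.AlgebraicGeometry.Motives

namespace CurvePlaces

open RatFn

variable {K : Type u} [Field K]

/-! ### The height of the generic point -/

/-- The height of the generic point of an irreducible scheme is its topological Krull dimension
(same statement and proof as `Scheme.height_genericPoint` of `Motives/BettiCycleClassProofs`, whose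
singular-homology import closure is not wanted here; kept private). [folklore] -/
private theorem height_genericPoint_eq_topologicalKrullDim' (Y : Scheme.{u}) [IrreducibleSpace Y] :
    (height (genericPoint Y) : WithBot ℕ∞) = topologicalKrullDim Y := by
  have hk : topologicalKrullDim Y = krullDim Y :=
    krullDim_eq_of_orderIso (irreducibleSetEquivPoints (α := Y))
  rw [hk]
  refine le_antisymm (height_le_krullDim _) ?_
  rw [krullDim_eq_iSup_height]
  exact iSup_le fun y ↦ WithBot.coe_le_coe.mpr
    (height_mono (Scheme.le_iff_specializes.mpr (genericPoint_specializes y)))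

/-! ### The surface `C × C` -/

section Surface

variable (C : SchemeOver K) [IsIntegral C.left] [SmoothOfRelativeDimension 1 C.hom] [IsProper C.hom]
  [GeometricallyIntegral C.hom]

/-- `C × C → Spec K` is smooth of relative dimension two. [folklore] -/
instance smoothOfRelativeDimension_two_tensor_hom : SmoothOfRelativeDimension 2 (C ⊗ C).hom := by
  haveI := smoothOfRelativeDimension_isStableUnderBaseChange (n := 1)
  haveI : SmoothOfRelativeDimension 1 (pullback.fst C.hom C.hom) :=
    MorphismProperty.pullback_fst _ _ ‹SmoothOfRelativeDimension 1 C.hom›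
  change SmoothOfRelativeDimension (1 + 1) (pullback.fst C.hom C.hom ≫ C.hom)
  infer_instance

omit [IsProper C.hom] [GeometricallyIntegral C.hom] in
/-- `C × C → Spec K` is smooth. [folklore] -/
instance smooth_tensor_hom : Smooth (C ⊗ C).hom := SmoothOfRelativeDimension.smooth 2 _

/-- `C × C` is integral (`C` geometrically integral). [folklore] -/
instance isIntegral_tensor_left : IsIntegral (C ⊗ C).left := by
  haveI : LocallyOfFinitePresentation C.hom := inferInstance
  haveI : UniversallyOpen C.hom := inferInstance
  change IsIntegral (pullback C.hom C.hom)
  infer_instance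

omit [IsProper C.hom] [GeometricallyIntegral C.hom] in
/-- `C × C` is locally noetherian. [folklore] -/
instance isLocallyNoetherian_tensor_left : IsLocallyNoetherian (C ⊗ C).left :=
  LocallyOfFiniteType.isLocallyNoetherian (C ⊗ C).hom

omit [IsIntegral C.left] [IsProper C.hom] [GeometricallyIntegral C.hom] in
/-- The local rings of the smooth surface `C × C` are regular. [folklore] -/
theorem isRegularLocalRing_stalk_tensor (z : (C ⊗ C).left) :
    IsRegularLocalRing ((C ⊗ C).left.presheaf.stalk z) :=
  isRegularLocalRing_stalk_of_smoothOfRelativeDimension_specOfRegular (C ⊗ C).hom 2 z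

/-- The local rings of the smooth surface `C × C` are factorial (Auslander–Buchsbaum, the tree's
`Matsumura1987_20_3_holds`). [folklore] -/
theorem uniqueFactorizationMonoid_stalk_tensor (z : (C ⊗ C).left) :
    UniqueFactorizationMonoid ((C ⊗ C).left.presheaf.stalk z) :=
  Resolution.Matsumura1987_20_3_holds _ (isRegularLocalRing_stalk_tensor C z)

/-- `dim (C × C) = 2`: the height of the generic point. [folklore] -/
theorem height_top_tensor : height (⊤ : ↥(C ⊗ C).left) = 2 := by
  have h1 := height_genericPoint_eq_topologicalKrullDim' (C ⊗ C).left
  haveI : Nonempty (C ⊗ C).left := inferInstance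
  haveI : SmoothOfRelativeDimension 2 ((C ⊗ C).left ↘ Spec (.of K)) :=
    smoothOfRelativeDimension_two_tensor_hom C
  rw [topologicalKrullDim_eq_of_smoothOfRelativeDimension ((C ⊗ C).left ↘ Spec (.of K)) (n := 2)] at h1
  change ((height (⊤ : ↥(C ⊗ C).left) : ℕ∞) : WithBot ℕ∞) = ((2 : ℕ∞) : WithBot ℕ∞) at h1
  exact WithBot.coe_injective h1

/-! ### The diagonal -/

/-- The diagonal morphism `C → C × C` over `K`. [folklore] -/
def diag : C ⟶ C ⊗ C := lift (𝟙 C) (𝟙 C)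

omit [IsIntegral C.left] [SmoothOfRelativeDimension 1 C.hom] [IsProper C.hom] [GeometricallyIntegral C.hom] in
/-- The underlying morphism of the diagonal is Mathlib's `pullback.diagonal`. [folklore] -/
theorem diag_left : (diag C).left = pullback.diagonal C.hom := by
  apply pullback.hom_ext <;> simp [diag, pullback.diagonal]

omit [IsIntegral C.left] [SmoothOfRelativeDimension 1 C.hom] [GeometricallyIntegral C.hom] in
/-- The diagonal of the separated `C` is a closed immersion. [folklore] -/
instance isClosedImmersion_diag_left : IsClosedImmersion (diag C).left := by
  rw [diag_left]
  exact IsSeparated.isClosedImmersion_diagonal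

/-- The diagonal `Δ ⊆ C × C` as a closed set. [folklore] -/
def diagonalSet : Set (C ⊗ C).left := Set.range (diag C).left.base

omit [IsIntegral C.left] [SmoothOfRelativeDimension 1 C.hom] [GeometricallyIntegral C.hom] in
/-- `Δ` is closed (`C` separated). [folklore] -/
theorem isClosed_diagonalSet : IsClosed (diagonalSet C) :=
  (diag C).left.isClosedEmbedding.isClosed_range

/-- The open complement `C × C ∖ Δ`. [folklore] -/
def diagonalCompl : (C ⊗ C).left.Opens := ⟨(diagonalSet C)ᶜ, (isClosed_diagonalSet C).isOpen_compl⟩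

omit [IsIntegral C.left] [SmoothOfRelativeDimension 1 C.hom] [GeometricallyIntegral C.hom] in
/-- Membership in `C × C ∖ Δ`. [folklore] -/
@[simp]
theorem mem_diagonalCompl_iff (z : (C ⊗ C).left) : z ∈ diagonalCompl C ↔ z ∉ diagonalSet C := Iff.rfl

/-- The generic point `δ₀` of the diagonal: the image of the generic point of `C`. [folklore] -/
def diagonalGenericPoint : (C ⊗ C).left := (diag C).left.base (genericPoint C.left)

omit [SmoothOfRelativeDimension 1 C.hom] [IsProper C.hom] [GeometricallyIntegral C.hom] in
/-- Every point of `Δ` is a specialisation of `δ₀`. [folklore] -/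
theorem diagonalGenericPoint_specializes {z : (C ⊗ C).left} (hz : z ∈ diagonalSet C) :
    diagonalGenericPoint C ⤳ z := by
  obtain ⟨c, rfl⟩ := hz
  exact (genericPoint_specializes c).map (diag C).left.continuous

omit [SmoothOfRelativeDimension 1 C.hom] [IsProper C.hom] [GeometricallyIntegral C.hom] in
/-- `δ₀ ∈ Δ`. [folklore] -/
theorem diagonalGenericPoint_mem : diagonalGenericPoint C ∈ diagonalSet C := ⟨_, rfl⟩

omit [GeometricallyIntegral C.hom] in
/-- `height δ₀ = 1` (closed immersions preserve heights; `dim C = 1`). [folklore] -/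
theorem height_diagonalGenericPoint : height (diagonalGenericPoint C) = 1 := by
  rw [diagonalGenericPoint, height_base_eq_of_isClosedImmersion' (diag C).left]
  exact height_top_of_smoothCurve C

/-- **`codim Δ = 1`**: `coheight δ₀ = 1` (`dim C × C = 2 = height δ₀ + coheight δ₀`, Stacks 0A21). [folklore] -/
theorem coheight_diagonalGenericPoint : coheight (diagonalGenericPoint C) = 1 := by
  haveI : LocallyOfFiniteType ((C ⊗ C).left ↘ Spec (.of K)) :=
    inferInstanceAs (LocallyOfFiniteType (C ⊗ C).hom)
  have h := Scheme.height_add_coheight_eq_height_top ((C ⊗ C).left ↘ Spec (.of K))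
    (diagonalGenericPoint C)
  rw [height_diagonalGenericPoint, height_top_tensor] at h
  -- `h : 1 + coheight δ₀ = 2` in `ℕ∞`
  have hne : coheight (diagonalGenericPoint C) ≠ ⊤ := by
    intro ht
    rw [ht] at h
    simp at h
  obtain ⟨n, hn⟩ := ENat.ne_top_iff_exists.mp hne
  rw [← hn] at h ⊢
  have h2 : ((1 + n : ℕ) : ℕ∞) = ((2 : ℕ) : ℕ∞) := by push_cast; exact h
  have h3 : 1 + n = 2 := by exact_mod_cast h2
  have h4 : n = 1 := by omega
  rw [h4]; rfl

/-- The generic point of `C × C` is off the diagonal; in particular `C × C ∖ Δ` is non-empty. [folklore] -/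
instance nonempty_diagonalCompl : Nonempty (diagonalCompl C) := by
  refine ⟨⟨genericPoint (C ⊗ C).left, fun h ↦ ?_⟩⟩
  -- if the generic point lies on `Δ` then `δ₀` is the generic point, of height `2 ≠ 1`
  have e : diagonalGenericPoint C = genericPoint (C ⊗ C).left :=
    ((diagonalGenericPoint_specializes C h).antisymm (genericPoint_specializes _)).eq
  have h1 := height_diagonalGenericPoint C
  rw [e] at h1
  have h2 := height_top_tensor C
  change height (genericPoint ↥(C ⊗ C).left) = 2 at h2
  rw [h1] at h2
  exact absurd h2 (by decide)

/-- **Purity of `Δ`**: on an affine chart `V` of `C × C`, the minimal primes of the radical ideal of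
`Δ` have height one (they are the prime of the generic point `δ₀` of `Δ`, of codimension one). [folklore] -/
theorem height_eq_one_of_mem_minimalPrimes_diagonal (V : (C ⊗ C).left.Opens) (hV : IsAffineOpen V)
    [Nonempty V] (P : Ideal Γ((C ⊗ C).left, V))
    (hP : P ∈ ((Scheme.IdealSheafData.vanishingIdeal (diagonalCompl C).compl).ideal
      ⟨V, hV⟩).minimalPrimes) : P.height = 1 := by
  classical
  haveI : P.IsPrime := hP.1.1
  set J := (Scheme.IdealSheafData.vanishingIdeal (diagonalCompl C).compl).ideal ⟨V, hV⟩ with hJ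
  -- the point `z` of `P`
  obtain ⟨zV, hzV⟩ : ∃ zV : V, hV.primeIdealOf zV = ⟨P, inferInstance⟩ := by
    obtain ⟨zV, hz⟩ := hV.isoSpec.hom.homeomorph.surjective ⟨P, inferInstance⟩
    exact ⟨zV, hz⟩
  have hmem : ∀ y : V, J ≤ (hV.primeIdealOf y).asIdeal ↔ (y : (C ⊗ C).left) ∈ diagonalSet C := by
    intro y
    rw [hJ, vanishingIdeal_ideal_le_primeIdealOf_iff hV (diagonalCompl C).compl y]
    change (y : (C ⊗ C).left) ∈ ((diagonalSet C)ᶜ)ᶜ ↔ _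
    rw [compl_compl]
  have hz : (zV : (C ⊗ C).left) ∈ diagonalSet C := (hmem zV).1 (by rw [hzV]; exact hP.1.2)
  -- `δ₀ ∈ V` and `P = 𝔭_{δ₀}`
  have hspec := diagonalGenericPoint_specializes C hz
  have hδV : diagonalGenericPoint C ∈ V := hspec.mem_open V.2 zV.2
  set δV : V := ⟨diagonalGenericPoint C, hδV⟩
  have hle : hV.primeIdealOf δV ≤ hV.primeIdealOf zV :=
    (Dimension.Scheme.specializes_iff_primeIdealOf_le hV δV zV).1 hspec
  have hJδ : J ≤ (hV.primeIdealOf δV).asIdeal := (hmem δV).2 (diagonalGenericPoint_mem C)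
  have hPeq : P = (hV.primeIdealOf δV).asIdeal := by
    apply le_antisymm
    · exact hP.2 ⟨inferInstance, hJδ⟩ (by rw [hzV] at hle; exact hle)
    · rw [hzV] at hle; exact hle
  -- heights
  have h1 := idealHeight_eq_coheight Γ((C ⊗ C).left, V) (hV.primeIdealOf δV)
  have h2 := coheight_eq_of_isOpenImmersion (x := hV.primeIdealOf δV) hV.fromSpec
  rw [hV.fromSpec_primeIdealOf] at h2
  rw [hPeq, h1, ← h2]
  exact coheight_diagonalGenericPoint C

/-- **The diagonal divisor `Δ` on `C × C`**: the reduced effective Cartier divisor with support the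
diagonal of the smooth proper geometrically integral curve `C` (Milne, *Jacobian Varieties*, §3,
Example 3.12: the sections `s_i(C^r)` of `C × C^r → C^r`, i.e. the pulled-back diagonals, as
relative effective divisors; here via the tree's `ComplementDivisor.divisorOfPure`, the local rings of
the smooth surface `C × C` being factorial and `Δ` of pure codimension one).
[cite: Milne1986JacobianVarieties, §3 Example 3.12] -/
def diagonalDivisor : CartierDivisor (C ⊗ C).left :=
  ComplementDivisor.divisorOfPure (uniqueFactorizationMonoid_stalk_tensor C) (U := diagonalCompl C)
    (height_eq_one_of_mem_minimalPrimes_diagonal C)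

/-- `Δ` is effective. [folklore] -/
theorem isEffective_diagonalDivisor : (diagonalDivisor C).IsEffective :=
  ComplementDivisor.isEffective_divisorOfPure _ _

/-- The support of `Δ` is the diagonal. [folklore] -/
theorem avoids_diagonalDivisor_iff (z : (C ⊗ C).left) :
    (diagonalDivisor C).Avoids z ↔ z ∉ diagonalSet C :=
  ComplementDivisor.avoids_divisorOfPure_iff _ _ z

/-- The local ring of `C × C` at the generic point of the diagonal is a discrete valuation ring
(a regular local ring of dimension one). [folklore] -/
instance isDiscreteValuationRing_stalk_diagonalGenericPoint :
    IsDiscreteValuationRing ((C ⊗ C).left.presheaf.stalk (diagonalGenericPoint C)) := by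
  haveI hreg := isRegularLocalRing_stalk_tensor C (diagonalGenericPoint C)
  have hdim : ringKrullDim ((C ⊗ C).left.presheaf.stalk (diagonalGenericPoint C)) = 1 := by
    rw [ringKrullDim_stalk_eq_coheight, coheight_diagonalGenericPoint]; rfl
  haveI : ValuationRing ((C ⊗ C).left.presheaf.stalk (diagonalGenericPoint C)) :=
    valuationRing_of_isRegularLocalRing_of_ringKrullDim_le_one _ hdim.le
  have hnf : ¬ IsField ((C ⊗ C).left.presheaf.stalk (diagonalGenericPoint C)) := fun hF ↦ by
    rw [ringKrullDim_eq_zero_of_isField hF] at hdim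
    exact absurd hdim (by decide)
  haveI : IsPrincipalIdealRing ((C ⊗ C).left.presheaf.stalk (diagonalGenericPoint C)) :=
    ((tfae_of_isNoetherianRing_of_isLocalRing_of_isDomain
      ((C ⊗ C).left.presheaf.stalk (diagonalGenericPoint C))).out 0 1).mpr ‹ValuationRing _›
  exact ⟨fun h ↦ hnf (IsLocalRing.isField_iff_maximalIdeal_eq.mpr h)⟩

/-- **`ord_{δ₀} Δ = 1`**: the diagonal divisor is reduced (its local equation at the generic point of
`Δ` generates a radical ideal of the discrete valuation ring `𝒪_{C×C,δ₀}`). [folklore] -/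
theorem ordAt_diagonalDivisor_genericPoint :
    (diagonalDivisor C).ordAt (diagonalGenericPoint C) = 1 := by
  set x := diagonalGenericPoint C
  obtain ⟨c, hc⟩ := (diagonalDivisor C).covers x
  rw [(diagonalDivisor C).ordAt_eq_ord hc]
  change Scheme.ord c.fn x = 1
  have hreg : IsRegularAt x c.fn := isEffective_diagonalDivisor C c x hc
  have hnu : ¬ IsUnitAt x c.fn := fun h ↦ ((c.isUnitAt_iff hc).1 h) (diagonalGenericPoint_mem C)
  have hrad : ComplementDivisor.RadicalAt x c.fn := c.radicalAt hc
  have hg0 : c.fn ≠ 0 := c.ne_zero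
  have hx1 : coheight x = 1 := coheight_diagonalGenericPoint C
  have hpos : 0 < Scheme.ord c.fn x := hreg.ord_pos hnu hg0 hx1
  -- a uniformizer `π` at `x`
  obtain ⟨ϖ, hϖ⟩ := IsDiscreteValuationRing.exists_irreducible ((C ⊗ C).left.presheaf.stalk x)
  set π := toFunctionField x ϖ
  have hπ0 : π ≠ 0 := (map_ne_zero_iff _ (toFunctionField_injective x)).2 hϖ.ne_zero
  have hπ : Scheme.ord π x = 1 := by
    change Scheme.ord (toFunctionField x ϖ) x = 1
    rw [ord_toFunctionField_eq_addVal hϖ.ne_zero, IsDiscreteValuationRing.addVal_uniformizer hϖ]; rfl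
  obtain ⟨m, hm⟩ : ∃ m : ℕ, Scheme.ord c.fn x = m :=
    ⟨(Scheme.ord c.fn x).toNat, (Int.toNat_of_nonneg hpos.le).symm⟩
  have hπreg : IsRegularAt x π := (isRegularAt_iff_ord_nonneg hπ0).2 (by omega)
  have h1 : IsRegularAt x (π ^ m / c.fn) := by
    rw [isRegularAt_iff_ord_nonneg (div_ne_zero (pow_ne_zero _ hπ0) hg0)]
    have e := Scheme.ord_mul (x := x) (div_ne_zero (pow_ne_zero m hπ0) hg0) hg0
    rw [div_mul_cancel₀ _ hg0, Scheme.ord_pow' hπ0, hπ] at e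
    omega
  have h2 := hrad π m hπreg h1
  rw [isRegularAt_iff_ord_nonneg (div_ne_zero hπ0 hg0)] at h2
  have e := Scheme.ord_mul (x := x) (div_ne_zero hπ0 hg0) hg0
  rw [div_mul_cancel₀ _ hg0, hπ] at e
  omega

end Surface

end CurvePlaces

end Literature.AlgebraicGeometry.Motives
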